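import Literature.AnabelianGeometry.EtaleTheta.FrobenioidMonoTheta
import HarnessLib

/-!
# [EtTh] Theorem 5.10 (i) and the arithmetic step of Lemma 5.8 — sub-DAG statements (L2 §K row K5)

Mochizuki, *The étale theta function and its Frobenioid-theoretic manifestations*, Publ. RIMS **45**
(2009) [cite: MochizukiEtTh2009, Thm 5.10 (i) p.333 (PDF p.107)], [cite: MochizukiEtTh2009, Lem 5.8 p.331 (PDF p.105)].
Layer L2 of the abc-iut cell, sub-DAG `plan/L2/SUBDAG-EtTh-Thm510i.md` (SUBDAG-WANTED (L2) §K row K5,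
abc-iut-L2-lead (gen 2) 2026-08-26T01:35Z; holder abc-iut-w4-d095).  STATEMENTS-ONLY file (D-0068 (1)
«statements first»): `Prop`-valued named statements over abc-iut-L2-t4's §5 data `ThetaFrobenioid`
(`FrobenioidTheta.lean`, `FrobenioidThetaBiKummer.lean`, `FrobenioidMonoTheta.lean`); nothing is asserted,
no `sorry`; the statements of record `ThetaFrobenioid.PreservesIsoClasses` (Thm. 5.10 (i)),
`ThetaFrobenioid.ConstantsEqNormalizer` / `ConstantsActByCyclotome` / `KxRootNModCyclotome` (Lemma 5.8) are
NOT restated — they are cited by name.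

## Part A. Theorem 5.10 (i) (statement p.333 (PDF p.107); proof p.334 (PDF p.108) ll.23–31)

"(i) The self-equivalence `Ψ : C ⥲ C` preserves the isomorphism classes of `A_N`, `B_N`."  Printed proof:
"Since `Ψ` preserves Frobenius-trivial objects [cf. the proof of Theorem 4.4], to show that `Ψ` preserves the
isomorphism class of `A_N`, it suffices to show that the equivalence `Ψ^bs : D ⥲ D` [cf. Theorem 4.4] induced
by `Ψ` preserves the isomorphism class of the objects of `D` determined by '`Z̈^log_{l·N}`', '`Ÿ^log`'; but
this follows immediately [in light of the definitions of the various tempered coverings involved] from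
Proposition 2.4.  Now the fact that `Ψ` preserves the isomorphism class of `B_N` follows immediately from
Proposition 5.3, (vi)."  The cut (rows T510i-L01…L09 of the sub-DAG) is EXACTLY the binder list of
abc-iut-L2-d4's landed discharge `ThetaFrobenioid.preservesIsoClasses_of` (`Discharge/Sec5Thm510i.lean`,
p408065); the three rows that are not yet NAMED statements of the §5 data are typed below
(`PsiPreservesFrobeniusTrivial`, `PsiBaseIsoAN`, `DivSCapTransported`); the [FrdI]-level rows (Thm. 5.1 (iii),
Thm. 3.4 (ii) "`Ψ` preserves pre-steps", Def. 1.3 (iii)(d)) are theorems of layer L1 at the model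
(abc-iut-L2-d4 `Discharge/Sec5ModelCase.lean`: `iso_of_baseIso_of_model`, `preservesPreSteps_of_model`,
`exists_iso_of_div_eq`) and are cited, not typed.

## Part B. Lemma 5.8, arithmetic step (p.331 (PDF p.105) ll.14–24)

Lemma 5.8: "`(O_K^×)^{1/N}` is equal to the set of elements of `O^×(B_N)` that normalize the subgroup
`E_N ⊆ Aut_C(B_N)`.  In particular, we have a natural outer action of `(O_K^×)^{1/N}/μ_N(B_N) (⥲ O_K^×)` on
`E_N`; this outer action extends to an outer action of `(K^×)^{1/N}/μ_N(B_N) (⥲ K^×)` on `E_N`."  Proof: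
"since `Y` is geometrically connected over `K`, … the set of elements of `O^×(B_N)` that normalize the subgroup
`E_N` … is equal to the set of elements on which `Π^tp_Y` [i.e., `G_K`, via the natural surjection
`Π^tp_Y ↠ G_K`] acts via multiplication by an element of `μ_N(B_N)`.  But this last set is easily seen to
coincide with `(O_K^×)^{1/N}`."  abc-iut-L2-t4 PROVED the group-theoretic step (`mem_normalizer_EN_iff`) and
typed the arithmetic step as the named fact `ConstantsActByCyclotome`.  This file cuts the arithmetic step
into (L58-A2) a KUMMER CRITERION that is pure group theory over the §5 data — PROVED in the companion
`FrobenioidMonoThetaThm510iSubProofs.lean` (`actsByCyclotome_iff_pow_invariant`) — and (L58-A3) the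
arithmetic input proper, "`(O^×(B_N))^{Π^tp_Y} = O_K^×`" ("`Y` geometrically connected over `K`", `K̈ = K`;
[EtTh] Prop. 3.4 (ii)), typed here as `InvariantUnitsEqConstants`; the companion proves
`ConstantsActByCyclotome ⟸ InvariantUnitsEqConstants`.  Finally (L58-B1) the `K^×`-EXTENSION sentence —
the one printed step that was not yet a statement of its own (abc-iut-L2-t4 MERGE-PLAN row 11, the `DK`
parameter of `frdBiThetaEnv`; abc-iut-L2-t11's `Sec5ConstantsKummer.lean` computes the `K^×`-part on the
§2 side as Kummer cocycle shifts, and the DK instance of record is the EXTRINSIC `DK₀` of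
`Sec5BiThetaIsoCanonical.lean`, L2-lead ruling 2026-08-26T01:44Z) — is typed INTRINSICALLY on the §5 side
as `IsKummerExtension` / `KxOuterActionExtends`: an action of `(K^×)^{1/N}` on `E_N` by "Kummer shifts"
(trivial modulo `μ_N(B_N)`) extending conjugation by `(O_K^×)^{1/N}`; over the abstract §5 data it is a
statement to be DISCHARGED at the genuine data (birational Galois action: `c_f(y) = y(f)·f⁻¹`), never a
hypothesis smuggled into a consumer.

HONEST FRAMING: [EtTh] is refereed, pre-IUT; typed ≠ proved; nothing here bears on [IUTchIII] Cor. 3.12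
or takes a side.
-/

namespace Literature.AnabelianGeometry.EtaleTheta

open CategoryTheory

universe w v v' u u'

namespace ThetaFrobenioid

variable {C : Type u} [Category.{v} C] {D : Type u'} [Category.{v'} D] (𝔉 : ThetaFrobenioid.{w} C D)

/-! ### Part A — Theorem 5.10 (i): the three un-named printed steps -/

/-- **T510i-L02** "Since `Ψ` preserves Frobenius-trivial objects [cf. the proof of Theorem 4.4]"
(p.334 (PDF p.108) l.23): the functor `Ψ` carries Frobenius-trivial objects of `C` to Frobenius-trivial
objects (abc-iut-L1's `PreFrobenioidData.PreservesObj` at `IsFrobeniusTrivial`; = binder `hΨFT` of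
abc-iut-L2-d4's `preservesIsoClasses_of`; at the §4 level this is the Thm. 4.4 sub-DAG row T44-L05
`BiKummerSetting.Thm44Hyp.PreservesFrobeniusTrivial`, PROVED there from [FrdI] Thm. 3.4 (ii)(iii)).
[cite: MochizukiEtTh2009, Thm 5.10 (i) proof p.334 (PDF p.108)] -/
def PsiPreservesFrobeniusTrivial (Ψ : C ⥤ C) : Prop :=
  Literature.AlgebraicGeometry.Frobenioids.PreFrobenioidData.PreservesObj Ψ
    𝔉.pre.IsFrobeniusTrivial 𝔉.pre.IsFrobeniusTrivial

/-- **T510i-L03** "it suffices to show that the equivalence `Ψ^bs : D ⥲ D` … preserves the isomorphism class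
of the objects of `D` determined by '`Z̈^log_{l·N}`', '`Ÿ^log`'; but this follows immediately [in light of the
definitions of the various tempered coverings involved] from Proposition 2.4" (p.334 (PDF p.108) ll.24–28), read
at `A_N` (whose base is the covering determined by `Z̈^log_{l·N}`): `Ψ(A_N)^bs ≅ A_N^bs` (= binder `hbs`;
input [EtTh] Prop. 2.4, abc-iut-L2-t2 `ThetaCovers.Prop24`, with the 1-compatibility `Base ∘ Ψ ≅ Ψ^bs ∘ Base`
of Thm. 4.4). [cite: MochizukiEtTh2009, Thm 5.10 (i) proof p.334 (PDF p.108)] -/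
def PsiBaseIsoAN (Ψ : C ⥤ C) : Prop :=
  𝔉.pre.BaseIsomorphic (Ψ.obj 𝔉.AN) 𝔉.AN

/-- **T510i-L08** "Now the fact that `Ψ` preserves the isomorphism class of `B_N` follows immediately from
Proposition 5.3, (vi)" (p.334 (PDF p.108) ll.29–31), in the shape abc-iut-L2-d4's discharge consumes (binder
`hdiv`): for every identification `α : Ψ(A_N) ⥲ A_N` the zero divisor of the transported pre-step
`α⁻¹ ≫ Ψ(s^⊓_N)` is the zero divisor of `ε ≫ s^⊓_N` for some `ε ∈ Aut_C(A_N)` — Prop. 5.3 (vi): "the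
`Aut_C(A_⊚)`-orbit of the divisor of zeroes and poles … of the theta function" is preserved (via Cor. 3.8
(iii)), read at the `N`-th root `s^⊓_N`. [cite: MochizukiEtTh2009, Thm 5.10 (i) proof p.334 (PDF p.108)] -/
def DivSCapTransported (Ψ : C ≌ C) : Prop :=
  ∀ α : Ψ.functor.obj 𝔉.AN ≅ 𝔉.AN, ∃ ε : Aut 𝔉.AN,
    𝔉.pre.div (α.inv ≫ Ψ.functor.map 𝔉.sCap) = 𝔉.pre.div (ε.hom ≫ 𝔉.sCap)

/-! ### Part B — Lemma 5.8, arithmetic step -/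

/-- **L58-A3** the arithmetic input of the proof of Lemma 5.8 (p.331 (PDF p.105) ll.20–24: "since `Y` is
geometrically connected over `K` … `Π^tp_Y` [i.e., `G_K`, via the natural surjection `Π^tp_Y ↠ G_K`] acts …";
[EtTh] Prop. 3.4 (ii) and "`K̈ = K`" (p.322 (PDF p.96))): **the units of `B_N` fixed by `Π^tp_Y` are exactly the
constant units**, `(O^×(B_N))^{Π^tp_Y̲} = O_K^×` — for `u ∈ O^×(B_N)`, `u` is fixed by conjugation through
`s^⊓-gp_N(Im Π^tp_Y̲)` iff its image in `O^×(B_N^birat)` lies in the image of `K^× ↪ O^×(B_N^birat)`.  Over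
the abstract §5 data (which carry no Galois action on `O^×(B_N^birat)`) this is the statement to be
discharged at the genuine data; with the Kummer criterion `actsByCyclotome_iff_pow_invariant` (companion
file, PROVED) it yields abc-iut-L2-t4's named arithmetic step `ConstantsActByCyclotome`
(`constantsActByCyclotome_of_invariantUnitsEqConstants`, companion file).
[cite: MochizukiEtTh2009, Lem 5.8 proof p.331 (PDF p.105)] -/
def InvariantUnitsEqConstants : Prop :=
  ∀ u : 𝔉.units 𝔉.BN,
    (∀ y ∈ 𝔉.imPiY, 𝔉.sgpCap y * (u : Aut 𝔉.BN) * (𝔉.sgpCap y)⁻¹ = u) ↔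
      𝔉.unitsToBirat 𝔉.BN u ∈ 𝔉.constEmb.range

/-- **L58-B1, shape** "this outer action extends to an outer action of `(K^×)^{1/N}/μ_N(B_N) (⥲ K^×)` on
`E_N`" (Lemma 5.8, p.331 (PDF p.105) ll.18–19): a *Kummer extension* of the conjugation action of the constants is
an action `act` of `(K^×)^{1/N} ⊆ O^×(B_N^birat)` on `E_N` by group automorphisms such that
(a) every `act f` is a KUMMER SHIFT — `act f (e) · e⁻¹ ∈ μ_N(B_N)` (at the genuine data:
`act f (e) = c_f(ē) · e` with `c_f(y) = y(f) · f⁻¹` the Kummer cocycle of `f`, `f^N ∈ K^×`; cf.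
abc-iut-L2-t11 `Sec5ConstantsKummer.envIso_conj_const`), and
(b) on `(O_K^×)^{1/N} = (K^×)^{1/N} ∩ O^×(B_N)` it IS conjugation inside `Aut_C(B_N)` (the action of the first
sentence, `FrobenioidMonoThetaEnv.constOut`).  By (b) the elements of `μ_N(B_N) ⊆ (O_K^×)^{1/N}` act by INNER
automorphisms of `E_N` (`μ_N(B_N) ⊆ E_N`), so `act` induces an OUTER action of `(K^×)^{1/N}/μ_N(B_N)`
(companion file); "`⥲ K^×`" is abc-iut-L2-t4's `KxRootNModCyclotome`.
[cite: MochizukiEtTh2009, Lem 5.8 p.331 (PDF p.105)] -/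
def IsKummerExtension (act : 𝔉.KxRootN →* MulAut 𝔉.EN) : Prop :=
  (∀ (f : 𝔉.KxRootN) (e : 𝔉.EN),
      ((act f e : 𝔉.EN) : Aut 𝔉.BN) * ((e : 𝔉.EN) : Aut 𝔉.BN)⁻¹ ∈ 𝔉.muTorsion 𝔉.BN 𝔉.N) ∧
  ∀ (u : 𝔉.units 𝔉.BN) (hu : 𝔉.unitsToBirat 𝔉.BN u ∈ 𝔉.KxRootN) (e : 𝔉.EN),
      ((act ⟨𝔉.unitsToBirat 𝔉.BN u, hu⟩ e : 𝔉.EN) : Aut 𝔉.BN) =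
        (u : Aut 𝔉.BN) * ((e : 𝔉.EN) : Aut 𝔉.BN) * (u : Aut 𝔉.BN)⁻¹

/-- **L58-B1** "this outer action extends to an outer action of `(K^×)^{1/N}/μ_N(B_N) (⥲ K^×)` on `E_N`"
(Lemma 5.8, p.331 (PDF p.105) ll.18–19): the conjugation action of `(O_K^×)^{1/N}` on `E_N` EXTENDS to a Kummer
action of `(K^×)^{1/N}` (`IsKummerExtension`).  The printed step behind abc-iut-L2-t4's `DK` parameter
(MERGE-PLAN row 11) — the `K^×`-part of `D` in Lemma 5.9 (iv); over the abstract §5 data a statement to be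
DISCHARGED at the genuine data from the birational Galois action (`Aut_{C^birat}(B_N^birat)`, [FrdI] Prop. 4.4),
on the §2 side computed by abc-iut-L2-t11 (`Sec5ConstantsKummer`, `Sec5BiThetaIsoCanonical`: `DK₀`).
[cite: MochizukiEtTh2009, Lem 5.8 p.331 (PDF p.105)] -/
def KxOuterActionExtends : Prop :=
  ∃ act : 𝔉.KxRootN →* MulAut 𝔉.EN, 𝔉.IsKummerExtension act

end ThetaFrobenioid

end Literature.AnabelianGeometry.EtaleTheta
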